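import Literature.Probability.RandomPlanarGeometry.SAWTriangularPolygonPairs
import Literature.Probability.RandomPlanarGeometry.SAWUnfoldingStep
import HarnessLib

/-!
# Polygons of the triangular lattice can be grown by one edge: `2N q_N(𝕋) ≤ 2(N+1) q_{N+1}(𝕋)`

Topic `Literature/Probability/RandomPlanarGeometry` (lane «pcv-sawmu», door «TRI-SAP»; continues
`SAWTriangularPolygonPairs.lean`: `brickAdjEnd n` = the `n`-step brick walks of `𝕋` from `0` ending next to `0` =
the rooted oriented `(n+1)`-gons, `triLoopCount (n+1) = #brickAdjEnd n`). Sources: N. Madras, G. Slade, *The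
Self-Avoiding Walk* (1993), §3.2, eq. (3.2.1)–(3.2.3) (p. 65: polygons of `ℤ^d` exist only for EVEN lengths,
and (3.2.3) `q_N ≤ q_{M+N−1}` is obtained by concatenation); on the triangular lattice polygons of every
length `≥ 3` exist, and a polygon is lengthened by ONE edge by a local move — inserting the outer apex of an
edge at the top vertex (the triangle outside the polygon). This elementary monotonicity is the lane's
substitute for the parity bookkeeping of the `ℤ^d` proof of Theorem 3.2.3; it is not located in print for `𝕋`
(the enumeration literature, e.g. Guttmann–Jensen, lists `q_N(𝕋)` increasing without comment).

## The move

For `ρ ∈ brickAdjEnd n` (`n ≥ 2`) let `t = ρ(p)` be a vertex of maximal brick height `X` (`p = Zd.lastArgmax n ρ`).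
Its two polygon-neighbours (the closing edge `(ρ(n), ρ(0))` included) are distinct sites of height `< X(t)`,
hence one of them is `u = t + (−1, ±1)` (both cannot be `t + (−2, 0)`), and the outer apex `z = t + (1, ±1)`
of the edge `{t, u}` (`z ~ t`, `z ~ u`) has height `X(t) + 1`, so it is not on the polygon: inserting `z`
into that edge gives a rooted oriented polygon with one more edge, and `z` is its unique top vertex, so the
move is injective (delete the top vertex).

## Contents (namespace `Literature.Probability.RandomPlanarGeometry.SAW`)

* `brickInsert n k z ρ` (insert `z` after position `k`; `k = n` appends), `brickInsert_mem_brickAdjEnd`,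
  `brickDelete`, `brickDelete_brickInsert`;
* `brickTopApex n ρ = (k, z)` (the chosen edge and apex `z = u + (2,0)`), `brickTopApex_spec`, `brickTopApex_fresh`;
* **`card_brickAdjEnd_le_succ : 2 ≤ n → #brickAdjEnd n ≤ #brickAdjEnd (n+1)`**,
  **`triLoopCount_le_succ : 3 ≤ N → triLoopCount N ≤ triLoopCount (N+1)`**, and the lane face
  **`sq_brickBridgeCount_le_mul_triLoopCount_odd : ∀ M ≥ 1, b_M(𝕋)² ≤ (2M+2)⁴ · triLoopCount (2M+3)`**.
-/

noncomputable section

open Finset Function Literature.Probability.LatticeModels Literature.Probability.Percolation SimpleGraph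

namespace Literature.Probability.RandomPlanarGeometry.SAW

open Zd

/-! ### Inserting a vertex into a rooted walk -/

/-- Insert the site `z` after position `k` of the frozen `n`-step walk `ρ` (positions `> k` shift by one;
`k = n` appends `z`); frozen after time `n + 1`. [cite: MadrasSlade1993, §3.2 eq. (3.2.3) (lengthening polygons)] -/
def brickInsert (n k : ℕ) (z : Site 2) (ρ : ℕ → Site 2) : ℕ → Site 2 := fun i =>
  if min i (n + 1) ≤ k then ρ (min i (n + 1)) else if min i (n + 1) = k + 1 then z else ρ (min i (n + 1) - 1)

section Insert

variable {n k : ℕ} {z : Site 2} {ρ : ℕ → Site 2}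

/-- Before the insertion point. [cite: MadrasSlade1993, §3.2 eq. (3.2.3)] -/
private theorem brickInsert_of_le {i : ℕ} (hi : i ≤ k) (hk : k ≤ n) : brickInsert n k z ρ i = ρ i := by
  simp only [brickInsert, min_eq_left (hi.trans (hk.trans (Nat.le_succ n))), if_pos hi]

/-- The inserted site. [cite: MadrasSlade1993, §3.2 eq. (3.2.3)] -/
private theorem brickInsert_succ (hk : k ≤ n) : brickInsert n k z ρ (k + 1) = z := by
  show (if min (k + 1) (n + 1) ≤ k then ρ (min (k + 1) (n + 1))
    else if min (k + 1) (n + 1) = k + 1 then z else ρ (min (k + 1) (n + 1) - 1)) = z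
  rw [min_eq_left (Nat.succ_le_succ hk), if_neg (Nat.not_succ_le_self k), if_pos rfl]

/-- After the insertion point (up to time `n+1`). [cite: MadrasSlade1993, §3.2 eq. (3.2.3)] -/
private theorem brickInsert_of_gt {i : ℕ} (hi : k + 1 < i) (hi' : i ≤ n + 1) :
    brickInsert n k z ρ i = ρ (i - 1) := by
  simp only [brickInsert, min_eq_left hi', if_neg (show ¬ i ≤ k by omega), if_neg (show i ≠ k + 1 by omega)]

/-- Frozen after time `n + 1`. [cite: MadrasSlade1993, §3.2 eq. (3.2.3)] -/
private theorem brickInsert_of_ge {i : ℕ} (hi : n + 1 ≤ i) : brickInsert n k z ρ i = brickInsert n k z ρ (n + 1) := by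
  simp only [brickInsert, min_eq_right hi, min_self]

/-- **The insertion of a fresh site adjacent to both ends of a polygon edge gives a rooted oriented polygon
with one more edge** (edge `(ρ(k), ρ(k+1))`, or the closing edge `(ρ(n), 0)` when `k = n`).
[cite: MadrasSlade1993, §3.2 eq. (3.2.1)–(3.2.3)] -/
theorem brickInsert_mem_brickAdjEnd (hρ : ρ ∈ brickAdjEnd n) (hk : k ≤ n) (hz1 : brickGraph.Adj (ρ k) z)
    (hz2 : k < n → brickGraph.Adj z (ρ (k + 1))) (hz3 : k = n → brickGraph.Adj z 0)
    (hfresh : ∀ i ≤ n, ρ i ≠ z) : brickInsert n k z ρ ∈ brickAdjEnd (n + 1) := by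
  obtain ⟨hρ, hlast⟩ := mem_brickAdjEnd.1 hρ
  obtain ⟨h0, hend, hadj, hinj⟩ := mem_brickSaws.1 hρ
  refine mem_brickAdjEnd.2 ⟨mem_brickSaws.2 ⟨?_, fun i hi => brickInsert_of_ge hi, fun i hi => ?_,
    fun a ha b hb hab => ?_⟩, ?_⟩
  · rw [brickInsert_of_le (Nat.zero_le k) hk, h0]
  · -- steps
    rcases Nat.lt_trichotomy (i + 1) (k + 1) with hlt | heq | hgt
    · rw [brickInsert_of_le (by omega) hk, brickInsert_of_le (by omega) hk]
      exact hadj i (by omega)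
    · have hik : i = k := by omega
      subst hik
      rw [brickInsert_of_le le_rfl hk, brickInsert_succ hk]
      exact hz1
    · rcases Nat.lt_or_ge (k + 1) i with hgt' | hle'
      · rw [brickInsert_of_gt hgt' (by omega), brickInsert_of_gt (by omega) (by omega),
          show i + 1 - 1 = (i - 1) + 1 by omega]
        exact hadj (i - 1) (by omega)
      · have hik : i = k + 1 := by omega
        subst hik
        rw [brickInsert_succ hk, brickInsert_of_gt (by omega) (by omega), Nat.add_sub_cancel]
        exact hz2 (by omega)
  · -- injective on `[0, n+1]`
    simp only [Set.mem_setOf_eq] at ha hb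
    -- values: `ρ j` (`j ≤ k`), `z`, `ρ (j-1)` (`j ≥ k+2`)
    have hval : ∀ {i}, i ≤ n + 1 → (i ≤ k ∧ brickInsert n k z ρ i = ρ i) ∨ (i = k + 1 ∧ brickInsert n k z ρ i = z) ∨
        (k + 1 < i ∧ brickInsert n k z ρ i = ρ (i - 1)) := by
      intro i hi
      rcases Nat.lt_trichotomy i (k + 1) with h | h | h
      · exact Or.inl ⟨by omega, brickInsert_of_le (by omega) hk⟩
      · exact Or.inr (Or.inl ⟨h, by rw [h, brickInsert_succ hk]⟩)
      · exact Or.inr (Or.inr ⟨h, brickInsert_of_gt h hi⟩)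
    rcases hval ha with ⟨ha', hva⟩ | ⟨ha', hva⟩ | ⟨ha', hva⟩ <;>
      rcases hval hb with ⟨hb', hvb⟩ | ⟨hb', hvb⟩ | ⟨hb', hvb⟩ <;>
      rw [hva, hvb] at hab
    · exact hinj (show a ≤ n by omega) (show b ≤ n by omega) hab
    · exact absurd hab (hfresh a (by omega))
    · have := hinj (show a ≤ n by omega) (show b - 1 ≤ n by omega) hab; omega
    · exact absurd hab.symm (hfresh b (by omega))
    · omega
    · exact absurd hab.symm (hfresh (b - 1) (by omega))
    · have := hinj (show a - 1 ≤ n by omega) (show b ≤ n by omega) hab; omega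
    · exact absurd hab (hfresh (a - 1) (by omega))
    · have := hinj (show a - 1 ≤ n by omega) (show b - 1 ≤ n by omega) hab; omega
  · -- the new endpoint is adjacent to `0`
    rcases hk.eq_or_lt with heq | hlt
    · rw [heq, brickInsert_succ le_rfl]
      exact hz3 heq
    · rw [brickInsert_of_gt (by omega) le_rfl, Nat.add_sub_cancel]
      exact hlast

/-- Delete position `q` of a frozen `(n+1)`-step walk (positions `> q` shift back); frozen after time `n`.
[cite: MadrasSlade1993, §3.2 eq. (3.2.3)] -/
def brickDelete (n q : ℕ) (ρ' : ℕ → Site 2) : ℕ → Site 2 := fun i =>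
  if min i n < q then ρ' (min i n) else ρ' (min i n + 1)

/-- Deleting the inserted site restores the walk. [cite: MadrasSlade1993, §3.2 eq. (3.2.3)] -/
theorem brickDelete_brickInsert (hend : ∀ i, n ≤ i → ρ i = ρ n) (hk : k ≤ n) :
    brickDelete n (k + 1) (brickInsert n k z ρ) = ρ := by
  funext i
  simp only [brickDelete]
  rcases le_or_gt i n with hi | hi
  · rw [min_eq_left hi]
    by_cases h : i < k + 1
    · rw [if_pos h, brickInsert_of_le (by omega) hk]
    · rw [if_neg h, brickInsert_of_gt (by omega) (by omega), Nat.add_sub_cancel]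
  · rw [min_eq_right hi.le, hend i hi.le]
    by_cases h : n < k + 1
    · rw [if_pos h, brickInsert_of_le (by omega) hk]
    · rw [if_neg h, brickInsert_of_gt (by omega) le_rfl, Nat.add_sub_cancel]

end Insert

/-! ### The top vertex and its outer apex -/

section Top

variable {n : ℕ} {ρ : ℕ → Site 2}

/-- The brick step `(2, 0)` (the outer apex of the edge `{t, u}` is `u + (2, 0)`). [cite: Grimmett2018, §5.5] -/
def brickE0 : Site 2 := fun i => if i = 0 then 2 else 0

/-- Coordinates of `(2, 0)`. [cite: Grimmett2018, §5.5] -/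
@[simp] theorem brickE0_apply_zero : brickE0 0 = 2 := rfl

/-- Coordinates of `(2, 0)`. [cite: Grimmett2018, §5.5] -/
@[simp] theorem brickE0_apply_one : brickE0 1 = 0 := rfl

/-- `u ~ u + (2, 0)`. [cite: Grimmett2018, §5.5] -/
theorem adj_add_brickE0 (u : Site 2) : brickGraph.Adj u (u + brickE0) := by
  rw [brickGraph_adj_iff]
  exact Or.inl ⟨by simp, Or.inl (by simp)⟩

/-- The (last) top vertex index `p` of a rooted walk. [cite: MadrasSlade1993, §3.2 (polygons as closed walks)] -/
private def topIdx (n : ℕ) (ρ : ℕ → Site 2) : ℕ := lastArgmax n ρ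

/-- Polygon-successor of the top vertex (cyclically). [cite: MadrasSlade1993, §3.2] -/
private def nextV (n : ℕ) (ρ : ℕ → Site 2) : Site 2 := if topIdx n ρ = n then ρ 0 else ρ (topIdx n ρ + 1)

/-- Polygon-predecessor of the top vertex (cyclically). [cite: MadrasSlade1993, §3.2] -/
private def prevV (n : ℕ) (ρ : ℕ → Site 2) : Site 2 := if topIdx n ρ = 0 then ρ n else ρ (topIdx n ρ - 1)

/-- **The chosen edge and apex** `(k, z)`: if the successor `u` of the top vertex `t` has height `X(t) − 1`,
insert `z = u + (2, 0)` into the edge `(t, u)` (after position `p`; the closing edge if `p = n`); otherwise the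
predecessor `u'` has height `X(t) − 1` and `z = u' + (2, 0)` goes into the edge `(u', t)` (after position
`p − 1`; the closing edge if `p = 0`). [cite: MadrasSlade1993, §3.2 eq. (3.2.3)] -/
def brickTopApex (n : ℕ) (ρ : ℕ → Site 2) : ℕ × Site 2 :=
  if (nextV n ρ) 0 = ρ (topIdx n ρ) 0 - 1 then (topIdx n ρ, nextV n ρ + brickE0)
  else (if topIdx n ρ = 0 then n else topIdx n ρ - 1, prevV n ρ + brickE0)

/-- **The chosen edge/apex are admissible** (`n ≥ 2`): `k ≤ n`, `ρ(k) ~ z`, `z ~ ρ(k+1)` (or `z ~ 0` on the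
closing edge), and `X(z) = max X + 1`. The top vertex's two polygon-neighbours are distinct (injectivity,
`n ≥ 2`) sites of smaller height adjacent to it, so not both are `t + (−2, 0)`.
[cite: MadrasSlade1993, §3.2 eq. (3.2.3)] -/
theorem brickTopApex_spec (hρ : ρ ∈ brickAdjEnd n) (hn : 2 ≤ n) :
    (brickTopApex n ρ).1 ≤ n ∧ brickGraph.Adj (ρ (brickTopApex n ρ).1) (brickTopApex n ρ).2 ∧
      ((brickTopApex n ρ).1 < n → brickGraph.Adj (brickTopApex n ρ).2 (ρ ((brickTopApex n ρ).1 + 1))) ∧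
      ((brickTopApex n ρ).1 = n → brickGraph.Adj (brickTopApex n ρ).2 0) ∧
      (brickTopApex n ρ).2 0 = maxLevel n ρ + 1 := by
  obtain ⟨hρS, hlast⟩ := mem_brickAdjEnd.1 hρ
  obtain ⟨h0, hend, hadj, hinj⟩ := mem_brickSaws.1 hρS
  obtain ⟨hp, hpmax⟩ := lastArgmax_spec n ρ
  have htop : ∀ i ≤ n, ρ i 0 ≤ ρ (lastArgmax n ρ) 0 := fun i hi => by rw [hpmax]; exact apply_le_maxLevel ρ hi
  -- the two polygon-neighbours of `t = ρ p` and their adjacency to `t`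
  have hnext_adj : brickGraph.Adj (ρ (lastArgmax n ρ)) (nextV n ρ) := by
    simp only [nextV, topIdx]
    split_ifs with h
    · rw [h, h0]; exact hlast
    · exact hadj _ (by omega)
  have hprev_adj : brickGraph.Adj (prevV n ρ) (ρ (lastArgmax n ρ)) := by
    simp only [prevV, topIdx]
    split_ifs with h
    · rw [h, h0]; exact hlast
    · have := hadj (lastArgmax n ρ - 1) (by omega)
      rwa [show lastArgmax n ρ - 1 + 1 = lastArgmax n ρ by omega] at this
  have hnext_le : (nextV n ρ) 0 ≤ ρ (lastArgmax n ρ) 0 := by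
    simp only [nextV, topIdx]
    split_ifs with h
    · exact htop 0 (Nat.zero_le n)
    · exact htop _ (by omega)
  have hprev_le : (prevV n ρ) 0 ≤ ρ (lastArgmax n ρ) 0 := by
    simp only [prevV, topIdx]
    split_ifs with h
    · exact htop n le_rfl
    · exact htop _ (by omega)
  have hne : nextV n ρ ≠ prevV n ρ := by
    simp only [nextV, prevV, topIdx]
    intro h
    split_ifs at h with h1 h2 h2
    · omega
    · have := hinj (show 0 ≤ n from Nat.zero_le n) (show lastArgmax n ρ - 1 ≤ n by omega) h; omega
    · have := hinj (show lastArgmax n ρ + 1 ≤ n by omega) (show n ≤ n from le_rfl) h; omega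
    · have := hinj (show lastArgmax n ρ + 1 ≤ n by omega) (show lastArgmax n ρ - 1 ≤ n by omega) h; omega
  have hn1 := hnext_adj; have hp1 := hprev_adj
  rw [brickGraph_adj_iff] at hn1 hp1
  -- unfold the choice
  unfold brickTopApex
  simp only [topIdx]
  by_cases hc : (nextV n ρ) 0 = ρ (lastArgmax n ρ) 0 - 1
  · rw [if_pos hc]
    refine ⟨hp, ?_, fun hlt => ?_, fun heq => ?_, ?_⟩
    · rw [brickGraph_adj_iff]; simp only [Pi.add_apply, brickE0_apply_zero, brickE0_apply_one]; omega
    · have hnv : nextV n ρ = ρ (lastArgmax n ρ + 1) := by simp only [nextV, topIdx, if_neg (show lastArgmax n ρ ≠ n by omega)]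
      rw [← hnv]
      exact (adj_add_brickE0 _).symm
    · have hnv : nextV n ρ = 0 := by simp only [nextV, topIdx, if_pos heq, h0]
      rw [hnv]
      exact (adj_add_brickE0 0).symm
    · simp only [Pi.add_apply, brickE0_apply_zero, ← hpmax]; omega
  · rw [if_neg hc]
    -- then the predecessor has height `X(t) − 1`: else both neighbours are `t + (−2, 0)`
    have hpc : (prevV n ρ) 0 = ρ (lastArgmax n ρ) 0 - 1 := by
      by_contra hpc'
      apply hne
      funext i; fin_cases i
      · show (nextV n ρ) 0 = (prevV n ρ) 0; omega
      · show (nextV n ρ) 1 = (prevV n ρ) 1; omega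
    by_cases hp0 : lastArgmax n ρ = 0
    · rw [if_pos hp0]
      have hpv : prevV n ρ = ρ n := by simp only [prevV, topIdx, if_pos hp0]
      rw [hpv] at hpc hp1 ⊢
      refine ⟨le_rfl, ?_, fun hlt => absurd hlt (lt_irrefl n), fun _ => ?_, ?_⟩
      · exact adj_add_brickE0 _
      · rw [hp0, h0] at hpc hp1
        rw [brickGraph_adj_iff]
        simp only [Pi.add_apply, brickE0_apply_zero, brickE0_apply_one, Pi.zero_apply] at hpc hp1 ⊢
        omega
      · simp only [Pi.add_apply, brickE0_apply_zero, ← hpmax]; omega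
    · rw [if_neg hp0]
      have hpv : prevV n ρ = ρ (lastArgmax n ρ - 1) := by simp only [prevV, topIdx, if_neg hp0]
      rw [hpv] at hpc hp1 ⊢
      refine ⟨by omega, ?_, fun _ => ?_, fun heq => by omega, ?_⟩
      · exact adj_add_brickE0 _
      · rw [show lastArgmax n ρ - 1 + 1 = lastArgmax n ρ by omega, brickGraph_adj_iff]
        simp only [Pi.add_apply, brickE0_apply_zero, brickE0_apply_one]; omega
      · simp only [Pi.add_apply, brickE0_apply_zero, ← hpmax]; omega

/-- The apex is not a vertex of the polygon (its height exceeds the maximum). [cite: MadrasSlade1993, §3.2] -/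
theorem brickTopApex_fresh (hρ : ρ ∈ brickAdjEnd n) (hn : 2 ≤ n) : ∀ i ≤ n, ρ i ≠ (brickTopApex n ρ).2 := by
  intro i hi h
  have h1 := apply_le_maxLevel ρ hi
  have h2 := (brickTopApex_spec hρ hn).2.2.2.2
  rw [← h] at h2
  omega

end Top

/-! ### Growing a polygon and the monotonicity -/

/-- **Grow a rooted oriented polygon by one edge**: insert the outer apex at the top vertex.
[cite: MadrasSlade1993, §3.2 eq. (3.2.3)] -/
def brickGrow (n : ℕ) (ρ : ℕ → Site 2) : ℕ → Site 2 :=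
  brickInsert n (brickTopApex n ρ).1 (brickTopApex n ρ).2 ρ

/-- The grown polygon is a rooted oriented polygon with one more edge. [cite: MadrasSlade1993, §3.2 eq. (3.2.3)] -/
theorem brickGrow_mem {n : ℕ} {ρ : ℕ → Site 2} (hρ : ρ ∈ brickAdjEnd n) (hn : 2 ≤ n) :
    brickGrow n ρ ∈ brickAdjEnd (n + 1) := by
  obtain ⟨hk, hz1, hz2, hz3, -⟩ := brickTopApex_spec hρ hn
  exact brickInsert_mem_brickAdjEnd hρ hk hz1 hz2 hz3 (brickTopApex_fresh hρ hn)

/-- In the grown polygon the inserted apex is the unique top vertex, at position `k + 1`.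
[cite: MadrasSlade1993, §3.2] -/
theorem lastArgmax_brickGrow {n : ℕ} {ρ : ℕ → Site 2} (hρ : ρ ∈ brickAdjEnd n) (hn : 2 ≤ n) :
    lastArgmax (n + 1) (brickGrow n ρ) = (brickTopApex n ρ).1 + 1 := by
  obtain ⟨hk, -, -, -, hz⟩ := brickTopApex_spec hρ hn
  set k := (brickTopApex n ρ).1 with hkdef
  set z := (brickTopApex n ρ).2 with hzdef
  have hval : brickGrow n ρ (k + 1) = z := brickInsert_succ hk
  have hother : ∀ i ≤ n + 1, i ≠ k + 1 → ∃ j ≤ n, brickGrow n ρ i = ρ j := by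
    intro i hi hne
    rcases Nat.lt_or_gt_of_ne hne with h | h
    · exact ⟨i, by omega, brickInsert_of_le (by omega) hk⟩
    · exact ⟨i - 1, by omega, brickInsert_of_gt h hi⟩
  refine (lastArgmax_eq_of (ω := brickGrow n ρ) (p := k + 1) (by omega) (fun i hi => ?_) (fun i hlt hi => ?_)).1
  · by_cases h : i = k + 1
    · rw [h]
    · obtain ⟨j, hj, hij⟩ := hother i hi h
      rw [hij, hval, hz]
      have := apply_le_maxLevel ρ hj
      omega
  · obtain ⟨j, hj, hij⟩ := hother i hi (by omega)
    rw [hij, hval, hz]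
    have := apply_le_maxLevel ρ hj
    omega

/-- Growing is undone by deleting the top vertex: a left inverse on `brickAdjEnd n`.
[cite: MadrasSlade1993, §3.2 eq. (3.2.3)] -/
theorem brickDelete_brickGrow {n : ℕ} {ρ : ℕ → Site 2} (hρ : ρ ∈ brickAdjEnd n) (hn : 2 ≤ n) :
    brickDelete n (lastArgmax (n + 1) (brickGrow n ρ)) (brickGrow n ρ) = ρ := by
  rw [lastArgmax_brickGrow hρ hn, brickGrow]
  exact brickDelete_brickInsert (mem_brickSaws.1 (mem_brickAdjEnd.1 hρ).1).2.1 (brickTopApex_spec hρ hn).1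

/-- **Monotonicity of the polygon counts of `𝕋`**: `#brickAdjEnd n ≤ #brickAdjEnd (n+1)` for `n ≥ 2`, i.e.
`2N q_N(𝕋) ≤ 2(N+1) q_{N+1}(𝕋)` for `N ≥ 3` (grow at the top vertex; injective). Not located in print for `𝕋`;
the `ℤ^d` substitute is Madras–Slade (3.2.3). [cite: MadrasSlade1993, §3.2 eq. (3.2.3)] -/
theorem card_brickAdjEnd_le_succ {n : ℕ} (hn : 2 ≤ n) : #(brickAdjEnd n) ≤ #(brickAdjEnd (n + 1)) := by
  refine Finset.card_le_card_of_injOn (brickGrow n) (fun ρ hρ => ?_) (fun ρ₁ h₁ ρ₂ h₂ h => ?_)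
  · exact Finset.mem_coe.2 (brickGrow_mem (Finset.mem_coe.1 hρ) hn)
  · rw [Finset.mem_coe] at h₁ h₂
    rw [← brickDelete_brickGrow h₁ hn, ← brickDelete_brickGrow h₂ hn, h]

/-- **`triLoopCount N ≤ triLoopCount (N + 1)` for `N ≥ 3`.** [cite: MadrasSlade1993, §3.2 eq. (3.2.3)] -/
theorem triLoopCount_le_succ {N : ℕ} (hN : 3 ≤ N) : triLoopCount N ≤ triLoopCount (N + 1) := by
  obtain ⟨n, rfl⟩ : ∃ n, N = n + 1 := ⟨N - 1, by omega⟩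
  rw [triLoopCount_succ, triLoopCount_succ]
  exact card_brickAdjEnd_le_succ (by omega)

/-- **Theorem 3.2.4 on `𝕋`, odd lengths (lane face `TriBridgePairLoopOdd`)**: `b_M(𝕋)² ≤ (2M+2)⁴ · triLoopCount (2M+3)`
for every `M ≥ 1` (the even statement and one growth step). [cite: MadrasSlade1993, Theorem 3.2.4 and eq. (3.2.3)] -/
theorem sq_brickBridgeCount_le_mul_triLoopCount_odd (M : ℕ) (hM : 1 ≤ M) :
    brickBridgeCount M ^ 2 ≤ (2 * M + 2) ^ 4 * triLoopCount (2 * M + 3) := by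
  refine (sq_brickBridgeCount_le_mul_triLoopCount M hM).trans (Nat.mul_le_mul_left _ ?_)
  exact triLoopCount_le_succ (by omega)

end Literature.Probability.RandomPlanarGeometry.SAW
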